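import Summits.HodgeConjecture.HodgeConjecture.Theorems.F0P3CMFrameOrbit            -- ★ `u21FrameEquivFin1_symm_expMem_smul`, ★ `reindex_symm_mem_uFormGroup_lie`
import Summits.HodgeConjecture.HodgeConjecture.Theorems.F0P2aL2eExpGeneration        -- ★ `subgroup_eq_top_of_forall_expMem_mem` (U(2,1) ball model)
import HarnessLib

/-!
# Crux `H413` — F1b road, brick (H3-gen): `U(2,1)_{Fin 2 ⊕ Fin 1}` is generated by its one-parameter subgroups

Floor-0 programme P3 «U3-mult», seat F0P3-p03 (g4); crux item stmt-HodgeConjecture-24833 (`HCCMUnconditional.H413`); rung-1 line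
`Cruxes/H413/Lines/F0_U3LettersRung1.lean` ed. 2.5, letter `stub_F1b_cm`; F0P3-plan (g2) ruling 2026-08-31T03:23:27Z (road F1b = Hilbert route,
step (H3) `C_Φ ≅ C_{Φ′}` — both proofs (H3-R ★ `F0P3ArchRepIsometricExtension`, H3-GNS) consume exp-GENERATION of the archimedean group in the CM
frame's index convention `uFormGroup (Fin 2) (Fin 1)`: the hypothesis `hgen : ∀ M : Subgroup G.carrier, (∀ X, G.expMem X ∈ M) → M = ⊤` of ★
`areUnitarilyEquivalent_closure_of_isometricIntertwiner`).  PROOF lane, no definition, no sorry; `--supports stmt-HodgeConjecture-24833`.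
HC_CM is proved only modulo the printed citations until rung 0 closes.

THE STATEMENT: a subgroup of `U(2,1)_{Fin 2 ⊕ Fin 1}` containing `exp X` for every `X ∈ 𝔲(2,1)_{Fin 2 ⊕ Fin 1}` is everything — transported from the
ball-model statement ★ `F0P2aL2eExpGeneration.subgroup_eq_top_of_forall_expMem_mem` (von Neumann–Cartan + connectedness of `U(2,1)`) along the
frame isomorphism ★ `u21FrameEquivFin1 : U21 ≃ₜ* UForm (Fin 2) (Fin 1)`, which matches one-parameter subgroups (★ `u21FrameEquivFin1_symm_expMem_smul`,
★ `reindex_symm_mem_uFormGroup_lie`). [cite: Knapp2002, I.§10 Cor. 1.103] [cite: Hall2015, Cor. 3.47]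
-/

set_option autoImplicit false
-- the mandated namespace repeats `HodgeConjecture.HodgeConjecture`, as in every `Theorems/*.lean` of this sub-problem
set_option linter.dupNamespace false

noncomputable section

open scoped Matrix MatrixGroups

namespace Summit.HodgeConjecture.HodgeConjecture.Cruxes.H413.F0P3UFormExpGeneration

open Literature.NumberTheory.Automorphic
open Literature.RepresentationTheory.KonnoKonno2007 Literature.RepresentationTheory.KonnoKonno2007.RealDualPair
open Literature.Geometry.ComplexHyperbolic Literature.Geometry.ComplexHyperbolic.BallModel
open Literature.AlgebraicGeometry.ShimuraVarieties Literature.AlgebraicGeometry.ShimuraVarieties.BallForms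
open Summit.HodgeConjecture.HodgeConjecture.Cruxes.H413.F0P3CMFrameOrbit
open Summit.HodgeConjecture.HodgeConjecture.Cruxes.H413.F0P2aL2cOrderedProducts (reindex_symm_mem_uFormGroup_lie)
open Summit.HodgeConjecture.HodgeConjecture.Cruxes.H413.F0P2aL2eExpGeneration (subgroup_eq_top_of_forall_expMem_mem)

/-- Every `exp X'`, `X' ∈ 𝔲(2,1)` (ball model), is the frame image of some `exp X`, `X ∈ 𝔲(2,1)_{Fin 2 ⊕ Fin 1}` (`X` = the reindexed matrix).
[cite: Knapp2002, I.§10 Cor. 1.103] -/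
theorem exists_expMem_eq_u21FrameEquivFin1_symm (X' : u21Group.lie) :
    ∃ X : (uFormGroup (Fin 2) (Fin 1)).lie, u21FrameEquivFin1.symm ((uFormGroup (Fin 2) (Fin 1)).expMem X) = u21Group.expMem X' := by
  refine ⟨⟨Matrix.reindex (finSumFinEquiv : Fin 2 ⊕ Fin 1 ≃ Fin 3).symm (finSumFinEquiv : Fin 2 ⊕ Fin 1 ≃ Fin 3).symm
      (X' : Matrix (Fin 3) (Fin 3) ℂ), reindex_symm_mem_uFormGroup_lie X'.2⟩, ?_⟩
  have hY : (X' : Matrix (Fin 3) (Fin 3) ℂ) = Matrix.reindex (finSumFinEquiv : Fin 2 ⊕ Fin 1 ≃ Fin 3) finSumFinEquiv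
      ((⟨Matrix.reindex (finSumFinEquiv : Fin 2 ⊕ Fin 1 ≃ Fin 3).symm (finSumFinEquiv : Fin 2 ⊕ Fin 1 ≃ Fin 3).symm
        (X' : Matrix (Fin 3) (Fin 3) ℂ), reindex_symm_mem_uFormGroup_lie X'.2⟩ : (uFormGroup (Fin 2) (Fin 1)).lie) :
        Matrix (Fin 2 ⊕ Fin 1) (Fin 2 ⊕ Fin 1) ℂ) := by
    ext i j
    simp [Matrix.reindex_apply, Matrix.submatrix_apply]
  have h := u21FrameEquivFin1_symm_expMem_smul _ X' hY 1
  rwa [one_smul, one_smul] at h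

/-- **`U(2,1)_{Fin 2 ⊕ Fin 1}` is generated by `exp 𝔲(2,1)_{Fin 2 ⊕ Fin 1}`**: a subgroup containing every `exp X` is `⊤` (★ ball-model statement
transported along the frame ★ `u21FrameEquivFin1`).  This is the `hgen` hypothesis of ★ `F0P3ArchRepIsometricExtension.areUnitarilyEquivalent_closure_of_isometricIntertwiner`
at `G := uFormGroup (Fin 2) (Fin 1)`. [cite: Knapp2002, I.§10 Cor. 1.103] [cite: Hall2015, Cor. 3.47] -/
theorem subgroup_eq_top_of_forall_expMem_mem_uForm (M : Subgroup ↥(uFormGroup (Fin 2) (Fin 1)).carrier)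
    (hM : ∀ X : (uFormGroup (Fin 2) (Fin 1)).lie, (uFormGroup (Fin 2) (Fin 1)).expMem X ∈ M) : M = ⊤ := by
  -- pull `M` back to the ball model
  let M' : Subgroup ↥U21 := M.comap (u21FrameEquivFin1 : U21 ≃ₜ* UForm (Fin 2) (Fin 1)).toMonoidHom
  have hM' : ∀ X' : u21Group.lie, (u21Group.expMem X' : ↥U21) ∈ M' := by
    intro X'
    obtain ⟨X, hX⟩ := exists_expMem_eq_u21FrameEquivFin1_symm X'
    have he : (u21FrameEquivFin1 : U21 ≃ₜ* UForm (Fin 2) (Fin 1)) (u21Group.expMem X') = (uFormGroup (Fin 2) (Fin 1)).expMem X := by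
      rw [← hX, ContinuousMulEquiv.apply_symm_apply]
    refine Subgroup.mem_comap.2 ?_
    change (u21FrameEquivFin1 : U21 ≃ₜ* UForm (Fin 2) (Fin 1)) (u21Group.expMem X') ∈ M
    rw [he]
    exact hM X
  have htop : M' = ⊤ := subgroup_eq_top_of_forall_expMem_mem M' hM'
  rw [eq_top_iff]
  intro g _
  have hg : u21FrameEquivFin1.symm g ∈ M' := by rw [htop]; exact Subgroup.mem_top _
  have hg' : (u21FrameEquivFin1 : U21 ≃ₜ* UForm (Fin 2) (Fin 1)) (u21FrameEquivFin1.symm g) ∈ M := Subgroup.mem_comap.1 hg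
  rwa [ContinuousMulEquiv.apply_symm_apply] at hg'

end Summit.HodgeConjecture.HodgeConjecture.Cruxes.H413.F0P3UFormExpGeneration

end
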